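import Literature.AlgebraicGeometry.Resolution.HuGammaSchemeResolutionProofs
import HarnessLib

/-!
# Hu's Plücker coordinates on the chart `p₁₂₃ ≠ 0` versus the `[I₃ | A]` model (Hu 2025, Prop. 3.6, Def. 7.1)

Topic: `Literature/AlgebraicGeometry/Resolution`. The statement file `HuGammaSchemeResolution.lean`
renders Hu's Γ-schemes `Z_Γ ⊆ 𝕌 ∩ Gr^{3,E}` (Y. Hu, arXiv:2507.21400, §1.5, §2.1–2.3, Def. 7.1)
in the `[I₃ | A]` model — `Z_Γ = Spec 𝔽[a_ij] ⧸ (3 × 3 minors of [I₃ | A] indexed by Γ)` — and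
justifies the model in its module docstring. This file makes that justification a THEOREM, in
Hu's own coordinates. Hu (§3.5, p. 20 of the TeX; Prop. 3.6; Def. 3.7; Def. 7.1):

> "By Proposition 3.6, `𝕌_Gr := 𝕌 ∩ Gr^{3,E}` is defined by the set of de-homogenized primary
> Plücker relations … `F̄_{(123),1uv} = x_{1uv} - x_{12u}x_{13v} + x_{13u}x_{12v}`,
> `F̄_{(123),2uv} = x_{2uv} - x_{12u}x_{23v} + x_{23u}x_{12v}`,
> `F̄_{(123),3uv} = x_{3uv} - x_{13u}x_{23v} + x_{23u}x_{13v}`,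
> `F̄_{(123),abc} = x_{abc} - x_{12a}x_{3bc} + x_{13a}x_{2bc} - x_{23a}x_{1bc}`,
> for all `3 < u < v` and `3 < a < b < c`." — "We call the variables in
> `var_𝕌 := {x_u ∣ u ∈ I_{3,n} ∖ 𝔪 ∖ I^lt_{3,n}}` the 𝔪-basic Plücker variables" — "`I_{℘,Γ} =
> ⟨x_u, F̄ ∣ x_u ∈ Γ, F̄ ∈ 𝓕⟩` … We let `Z_Γ` be the closed subscheme of the affine space `𝕌`
> defined by the ideal `I_{℘,Γ}`."

With `n = m + 3` and frame `𝔪 = (123)`, a Plücker variable `x_u`, `u ∈ I_{3,n} ∖ {(123)}`, has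
`2`, `1` or `0` indices in the frame; accordingly we index Hu's variables by the type

  `HuVar m = (Fin 3 × Fin m) ⊕ (Fin 3 × {a < b}) ⊕ {a < b < c}`

— **basic** `x_{𝔪∖k, a}` (`x_{23a}, x_{13a}, x_{12a}` for `k = 0, 1, 2`), **rank 0** `x_{(k+1)ab}`,
**rank 1** `x_{abc}` (Def. 3.7, (3.5)) — and prove, over any commutative ring `R`:

* `HuVar.toTriple` — the ordered column triple of `[I₃ | A]` a variable names, and `plEval` —
  **Hu's variable `x_u ↦` the tree's minor `HuGamma.minor R m (toTriple u)`**, an `R`-algebra map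
  `R[x_u : u ∈ HuVar m] → R[a_ij]`; on basic variables `x_{𝔪∖k,a} ↦ (-1)^k a_{ka}`
  (`plEval_X_basic`; Hu §2.2: `x_{12u} = a_{3u}`, `x_{13u} = -a_{2u}`, `x_{23u} = a_{1u}` up to the
  row convention);
* `primaryRel` — **the `(123)`-primary relations (3.5) verbatim** as polynomials in Hu's
  variables, indexed by their leading variables `LeadVar m = (Fin 3 × {a < b}) ⊕ {a < b < c}`
  (`= I^lt_{3,n}`); `plEval_primaryRel` — they hold in the model (`x_u ↦ minor` kills them:
  the tree's `HuGamma.primaryPlucker_*`);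
* `ker_plEval` — **Prop. 3.6 in the model: the kernel of `x_u ↦ minor_u` is EXACTLY the ideal
  `(𝓕)` of the primary relations**, and `plEval` is surjective (`plEval_surjective`); so
  `R[x_u] ⧸ (𝓕) ≅ R[a_ij]` (`plQuotientEquiv`): the chart `𝕌 ∩ Gr^{3,E}` with Hu's equations IS
  the affine space of matrices `[I₃ | A]` (the relations are triangular in the order basic <
  rank 0 < rank 1, Prop. 3.8; the inverse is `plSection`, `a_{ka} ↦ (-1)^k x_{𝔪∖k,a}`);
* `quotientPlGammaIdealEquiv` — **Def. 7.1 versus the tree**: for `Γ ⊆ HuVar m`,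
  `R[x_u] ⧸ I_{℘,Γ} ≅ HuGamma.ring R m (toTriple '' Γ)`, `I_{℘,Γ} = (𝓕) + (x_u : u ∈ Γ)`
  (`plGammaIdeal`). Hence Hu's `Z_Γ` is the tree's `Spec (HuGamma.ring R m (toTriple '' Γ))`, and
  the claim `Hu2025IntegralGammaSchemeResolution` (quantified over ALL sets of column triples)
  contains Hu's Thm. 1.3 family verbatim; conversely a triple repeating a column has minor `0`
  and a permuted triple the same minor up to sign (`HuGamma.minor_eq_zero_of_not_injective`,
  `HuGamma.span_minor_comp_perm`), so the tree's family of Γ-schemes is Hu's.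

Everything is proved; no named facts (D-0026).

## References

* Y. Hu, *Universal Characteristic-free Resolution of Singularities, I*, arXiv:2507.21400 (2025),
  §2.2–2.3, §3.2–3.5 (Prop. 3.6, Def. 3.7, Prop. 3.8, (3.5)), §7.1 Def. 7.1 (theorem numbers of
  the arXiv v1 TeX source). [Hu2025]
-/

noncomputable section

open MvPolynomial

namespace Literature.AlgebraicGeometry.Resolution

universe u

/-! ### Hu's variables on the chart `p₁₂₃ ≠ 0`, by frame pattern -/

/-- Increasing pairs `a < b` of `A`-columns. [cite: Hu2025, §3.5 (3.5)] -/
abbrev HuPair (m : ℕ) : Type := {p : Fin m × Fin m // p.1 < p.2}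

/-- Increasing triples `a < b < c` of `A`-columns. [cite: Hu2025, §3.5 (3.5)] -/
abbrev HuTripleIdx (m : ℕ) : Type := {t : Fin m × Fin m × Fin m // t.1 < t.2.1 ∧ t.2.1 < t.2.2}

/-- **The leading (non-basic) variables `I^lt_{3,n}`**: rank `0` ones `x_{(k+1)ab}` (one frame
index) and rank `1` ones `x_{abc}` (no frame index); they index the primary relations `𝓕`.
[cite: Hu2025, §3.2 and §3.5] -/
abbrev LeadVar (m : ℕ) : Type := (Fin 3 × HuPair m) ⊕ HuTripleIdx m

/-- **Hu's Plücker variables `x_u`, `u ∈ I_{3,n} ∖ {(123)}`, `n = m + 3`**, by the number of frame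
indices: basic `x_{𝔪∖k,a}` (two frame indices: `x_{23a}, x_{13a}, x_{12a}` for `k = 0, 1, 2`),
then the leading variables. [cite: Hu2025, Def. 3.7 and §3.5] -/
abbrev HuVar (m : ℕ) : Type := (Fin 3 × Fin m) ⊕ LeadVar m

namespace HuVar

variable {m : ℕ}

/-- The basic variable `x_{𝔪∖k, a}`. [cite: Hu2025, Def. 3.7] -/
abbrev basic (k : Fin 3) (a : Fin m) : HuVar m := Sum.inl (k, a)

/-- The rank-0 leading variable `x_{(k+1)ab}`, `a < b`. [cite: Hu2025, §3.5] -/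
abbrev rk0 (k : Fin 3) (p : HuPair m) : HuVar m := Sum.inr (Sum.inl (k, p))

/-- The rank-1 leading variable `x_{abc}`, `a < b < c`. [cite: Hu2025, §3.5] -/
abbrev rk1 (t : HuTripleIdx m) : HuVar m := Sum.inr (Sum.inr t)

/-- The two frame columns other than `k`, in increasing order. [folklore] -/
def framePair (k : Fin 3) : Fin 2 → Fin 3 :=
  ![![1, 2], ![0, 2], ![0, 1]] k

/-- **The ordered column triple of `[I₃ | A]` named by a variable**: `x_{𝔪∖k,a} ↦ (frame pair, a)`,
`x_{(k+1)ab} ↦ (k, a, b)`, `x_{abc} ↦ (a, b, c)`. [cite: Hu2025, §2.2 and §3.2] -/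
def toTriple : HuVar m → Fin 3 → Fin 3 ⊕ Fin m
  | Sum.inl (k, a) => ![Sum.inl (framePair k 0), Sum.inl (framePair k 1), Sum.inr a]
  | Sum.inr (Sum.inl (k, p)) => ![Sum.inl k, Sum.inr p.1.1, Sum.inr p.1.2]
  | Sum.inr (Sum.inr t) => ![Sum.inr t.1.1, Sum.inr t.1.2.1, Sum.inr t.1.2.2]

/-- The triple of a basic variable. [folklore] -/
@[simp] theorem toTriple_basic (k : Fin 3) (a : Fin m) :
    toTriple (basic k a) = ![Sum.inl (framePair k 0), Sum.inl (framePair k 1), Sum.inr a] := rfl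

/-- The triple of a rank-0 leading variable. [folklore] -/
@[simp] theorem toTriple_rk0 (k : Fin 3) (p : HuPair m) :
    toTriple (rk0 k p) = ![Sum.inl k, Sum.inr p.1.1, Sum.inr p.1.2] := rfl

/-- The triple of a rank-1 leading variable. [folklore] -/
@[simp] theorem toTriple_rk1 (t : HuTripleIdx m) :
    toTriple (rk1 t) = ![Sum.inr t.1.1, Sum.inr t.1.2.1, Sum.inr t.1.2.2] := rfl

end HuVar

/-! ### `x_u ↦ minor_u`: Hu's coordinates read in the `[I₃ | A]` model -/

section Eval

variable (R : Type u) [CommRing R] (m : ℕ)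

/-- **Hu's variable `x_u` ↦ the `3 × 3` minor of `[I₃ | A]` on the columns `u`** (the
de-homogenised Plücker coordinate `p_u / p_{123}` on the chart). [cite: Hu2025, §2.2 and §3.3] -/
def plEval : MvPolynomial (HuVar m) R →ₐ[R] MvPolynomial (Fin 3 × Fin m) R :=
  aeval fun v => HuGamma.minor R m (HuVar.toTriple v)

/-- `x_u ↦ minor_u` on a variable. [cite: Hu2025, §2.2 and §3.3] -/
@[simp] theorem plEval_X (v : HuVar m) :
    plEval R m (X v) = HuGamma.minor R m (HuVar.toTriple v) := by
  simp [plEval]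

/-- **Basic variables are the matrix entries up to sign**: `x_{𝔪∖k,a} ↦ (-1)^k a_{ka}`
(`x_{23a} = a_{1a}`, `x_{13a} = -a_{2a}`, `x_{12a} = a_{3a}` in Hu's numbering, §2.2).
[cite: Hu2025, §2.2] -/
theorem plEval_X_basic (k : Fin 3) (a : Fin m) :
    plEval R m (X (HuVar.basic k a)) = (-1) ^ (k : ℕ) * X (k, a) := by
  rw [plEval_X, HuVar.toTriple_basic]
  fin_cases k
  · simp [HuVar.framePair, HuGamma.minor_frame12]
  · simp [HuVar.framePair, HuGamma.minor_frame02]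
  · simp [HuVar.framePair, HuGamma.minor_frame01]

/-! ### The primary relations (3.5) -/

/-- **The `(123)`-primary Plücker relations, verbatim** (Hu (3.5)):
`F̄_{(123),1ab} = x_{1ab} - x_{12a}x_{13b} + x_{13a}x_{12b}`,
`F̄_{(123),2ab} = x_{2ab} - x_{12a}x_{23b} + x_{23a}x_{12b}`,
`F̄_{(123),3ab} = x_{3ab} - x_{13a}x_{23b} + x_{23a}x_{13b}` (`a < b`), and
`F̄_{(123),abc} = x_{abc} - x_{12a}x_{3bc} + x_{13a}x_{2bc} - x_{23a}x_{1bc}` (`a < b < c`), indexed by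
their leading variables (basic variables: `x_{12a} = x_{𝔪∖2,a}`, `x_{13a} = x_{𝔪∖1,a}`,
`x_{23a} = x_{𝔪∖0,a}`). [cite: Hu2025, §3.5 (3.5)] -/
def primaryRel : LeadVar m → MvPolynomial (HuVar m) R
  | Sum.inl (k, p) =>
    ![X (HuVar.rk0 0 p) - X (HuVar.basic 2 p.1.1) * X (HuVar.basic 1 p.1.2) +
        X (HuVar.basic 1 p.1.1) * X (HuVar.basic 2 p.1.2),
      X (HuVar.rk0 1 p) - X (HuVar.basic 2 p.1.1) * X (HuVar.basic 0 p.1.2) +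
        X (HuVar.basic 0 p.1.1) * X (HuVar.basic 2 p.1.2),
      X (HuVar.rk0 2 p) - X (HuVar.basic 1 p.1.1) * X (HuVar.basic 0 p.1.2) +
        X (HuVar.basic 0 p.1.1) * X (HuVar.basic 1 p.1.2)] k
  | Sum.inr t =>
    X (HuVar.rk1 t) -
        X (HuVar.basic 2 t.1.1) * X (HuVar.rk0 2 ⟨t.1.2, t.2.2⟩) +
      X (HuVar.basic 1 t.1.1) * X (HuVar.rk0 1 ⟨t.1.2, t.2.2⟩) -
      X (HuVar.basic 0 t.1.1) * X (HuVar.rk0 0 ⟨t.1.2, t.2.2⟩)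

/-- **The primary relations hold on the model** `[I₃ | A]`: `x_u ↦ minor_u` kills every `F̄ ∈ 𝓕`
(the tree's `HuGamma.primaryPlucker_one/two/three/abc`). [cite: Hu2025, §2.2 and Prop. 3.6] -/
theorem plEval_primaryRel (F : LeadVar m) : plEval R m (primaryRel R m F) = 0 := by
  rcases F with ⟨k, p⟩ | t
  · fin_cases k
    · simp [primaryRel, HuVar.framePair, HuGamma.primaryPlucker_one]
    · simp [primaryRel, HuVar.framePair, HuGamma.primaryPlucker_two]
    · simp [primaryRel, HuVar.framePair, HuGamma.primaryPlucker_three]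
  · simp [primaryRel, HuVar.framePair, HuGamma.primaryPlucker_abc]
    ring

/-- **The ideal `(𝓕)` of the primary relations** — Hu's `I_{℘,∅}`, the ideal of `𝕌 ∩ Gr^{3,E}` in
`𝕌` (Prop. 3.6). [cite: Hu2025, Prop. 3.6 and Def. 7.1] -/
def plIdeal : Ideal (MvPolynomial (HuVar m) R) := Ideal.span (Set.range (primaryRel R m))

/-- Each primary relation lies in `(𝓕)`. [folklore] -/
theorem primaryRel_mem_plIdeal (F : LeadVar m) : primaryRel R m F ∈ plIdeal R m :=
  Ideal.subset_span ⟨F, rfl⟩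

/-- `(𝓕) ⊆ ker (x_u ↦ minor_u)`. [cite: Hu2025, Prop. 3.6] -/
theorem plIdeal_le_ker : plIdeal R m ≤ RingHom.ker (plEval R m) := by
  rw [plIdeal, Ideal.span_le]
  rintro _ ⟨F, rfl⟩
  exact plEval_primaryRel R m F

/-! ### Prop. 3.6: `R[x_u] ⧸ (𝓕) ≅ R[a_ij]` -/

/-- **The inverse on the model**: `a_{ka} ↦ (-1)^k x_{𝔪∖k, a}` (every function on `[I₃ | A]` is a
polynomial in the basic variables, Prop. 3.6). [cite: Hu2025, Prop. 3.6] -/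
def plSection : MvPolynomial (Fin 3 × Fin m) R →ₐ[R] MvPolynomial (HuVar m) R :=
  aeval fun ka => (-1) ^ (ka.1 : ℕ) * X (HuVar.basic ka.1 ka.2)

/-- The section on a matrix entry: `a_{ka} ↦ (-1)^k x_{𝔪∖k, a}`. [cite: Hu2025, Prop. 3.6] -/
@[simp] theorem plSection_X (k : Fin 3) (a : Fin m) :
    plSection R m (X (k, a)) = (-1) ^ (k : ℕ) * X (HuVar.basic k a) := by
  simp [plSection]

/-- `(x_u ↦ minor_u) ∘ (a_{ka} ↦ ± x_{𝔪∖k,a}) = id`. [cite: Hu2025, Prop. 3.6] -/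
theorem plEval_comp_plSection : (plEval R m).comp (plSection R m) = AlgHom.id R _ := by
  refine MvPolynomial.algHom_ext fun ka => ?_
  obtain ⟨k, a⟩ := ka
  rw [AlgHom.comp_apply, plSection_X, map_mul, map_pow, map_neg, map_one, plEval_X_basic,
    AlgHom.id_apply, ← mul_assoc, ← mul_pow, neg_one_mul, neg_neg, one_pow, one_mul]

/-- Pointwise: `plEval (plSection q) = q`. [cite: Hu2025, Prop. 3.6] -/
theorem plEval_plSection (q : MvPolynomial (Fin 3 × Fin m) R) : plEval R m (plSection R m q) = q := by
  have h := congrArg (fun φ => φ q) (plEval_comp_plSection R m)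
  simpa using h

/-- `x_u ↦ minor_u` is surjective (`𝕌 ∩ Gr ↪ 𝕌` is a closed immersion onto its image, the graph
of the non-basic minors over the basic ones). [cite: Hu2025, Prop. 3.6] -/
theorem plEval_surjective : Function.Surjective (plEval R m) :=
  fun q => ⟨plSection R m q, plEval_plSection R m q⟩

/-- `(a ↦ ±x) (± a_{ka}) = x_{𝔪∖k,a}`: the section recovers the basic variables exactly. [folklore] -/
theorem plSection_plEval_X_basic (k : Fin 3) (a : Fin m) :
    plSection R m (plEval R m (X (HuVar.basic k a))) = X (HuVar.basic k a) := by
  rw [plEval_X_basic, map_mul, map_pow, map_neg, map_one, plSection_X, ← mul_assoc, ← mul_pow,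
    neg_one_mul, neg_neg, one_pow, one_mul]

/-- **Triangularity (Prop. 3.6 / 3.8)**: modulo `(𝓕)`, every variable `x_u` is congruent to the
polynomial in the basic variables obtained by reading its minor back through the section:
`plSection (plEval x_u) ≡ x_u (mod 𝓕)`. [cite: Hu2025, Prop. 3.6 and Prop. 3.8] -/
theorem plSection_plEval_X_sub_X_mem (v : HuVar m) :
    plSection R m (plEval R m (X v)) - X v ∈ plIdeal R m := by
  rcases v with ⟨k, a⟩ | ⟨k, p⟩ | t
  · rw [show (Sum.inl (k, a) : HuVar m) = HuVar.basic k a from rfl, plSection_plEval_X_basic,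
      sub_self]
    exact Ideal.zero_mem _
  · -- rank 0: `x_{(k+1)ab} ≡` the quadratic in the basic variables, by `F̄_{(123),(k+1)ab}`
    have hF := Submodule.neg_mem _ (primaryRel_mem_plIdeal R m (Sum.inl (k, p)))
    convert hF using 1
    rw [plEval_X]
    fin_cases k
    · simp [primaryRel, HuGamma.primaryPlucker_one, HuGamma.minor_frame01, HuGamma.minor_frame02]
      ring
    · simp [primaryRel, HuGamma.primaryPlucker_two, HuGamma.minor_frame01, HuGamma.minor_frame12]
      ring
    · simp [primaryRel, HuGamma.primaryPlucker_three, HuGamma.minor_frame02, HuGamma.minor_frame12]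
      ring
  · -- rank 1: expand `x_{abc}` along the first column (`F̄_{(123),abc}`), then reduce the three
    -- rank-0 minors by their own primary relations
    let bc : HuPair m := ⟨t.1.2, t.2.2⟩
    have hF := primaryRel_mem_plIdeal R m (Sum.inr t)
    have h0 := primaryRel_mem_plIdeal R m (Sum.inl (0, bc))
    have h1 := primaryRel_mem_plIdeal R m (Sum.inl (1, bc))
    have h2 := primaryRel_mem_plIdeal R m (Sum.inl (2, bc))
    -- the combination `-F̄_abc - x_{12a} F̄_{3bc} + x_{13a} F̄_{2bc} - x_{23a} F̄_{1bc}` lies in `(𝓕)`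
    have hmem : -(primaryRel R m (Sum.inr t)) -
        X (HuVar.basic 2 t.1.1) * primaryRel R m (Sum.inl (2, bc)) +
        X (HuVar.basic 1 t.1.1) * primaryRel R m (Sum.inl (1, bc)) -
        X (HuVar.basic 0 t.1.1) * primaryRel R m (Sum.inl (0, bc)) ∈ plIdeal R m :=
      Ideal.sub_mem _ (Ideal.add_mem _ (Ideal.sub_mem _ (Submodule.neg_mem _ hF)
        (Ideal.mul_mem_left _ _ h2)) (Ideal.mul_mem_left _ _ h1)) (Ideal.mul_mem_left _ _ h0)
    convert hmem using 1
    rw [plEval_X, HuVar.toTriple_rk1]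
    simp [bc, primaryRel, HuGamma.primaryPlucker_abc, HuGamma.primaryPlucker_one,
      HuGamma.primaryPlucker_two, HuGamma.primaryPlucker_three, HuGamma.minor_frame01,
      HuGamma.minor_frame02, HuGamma.minor_frame12]
    ring

/-- Hence `plSection (plEval f) ≡ f (mod 𝓕)` for every polynomial `f` in Hu's variables. [folklore] -/
theorem plSection_plEval_sub_mem (f : MvPolynomial (HuVar m) R) :
    plSection R m (plEval R m f) - f ∈ plIdeal R m := by
  have h : (Ideal.Quotient.mkₐ R (plIdeal R m)).comp ((plSection R m).comp (plEval R m)) =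
      Ideal.Quotient.mkₐ R (plIdeal R m) := by
    refine MvPolynomial.algHom_ext fun v => ?_
    rw [AlgHom.comp_apply, AlgHom.comp_apply, Ideal.Quotient.mkₐ_eq_mk, Ideal.Quotient.eq]
    exact plSection_plEval_X_sub_X_mem R m v
  have hf := congrArg (fun φ => φ f) h
  simp only [AlgHom.comp_apply, Ideal.Quotient.mkₐ_eq_mk] at hf
  exact Ideal.Quotient.eq.mp hf

/-- **Prop. 3.6 in the `[I₃ | A]` model: the kernel of `x_u ↦ minor_u` is exactly `(𝓕)`** — the
de-homogenised primary Plücker relations generate all relations among the Plücker coordinates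
on the chart. [cite: Hu2025, Prop. 3.6] -/
theorem ker_plEval : RingHom.ker (plEval R m) = plIdeal R m := by
  refine le_antisymm (fun f hf => ?_) (plIdeal_le_ker R m)
  have h := plSection_plEval_sub_mem R m f
  rw [RingHom.mem_ker] at hf
  rw [hf, map_zero, zero_sub, Ideal.neg_mem_iff] at h
  exact h

/-- **`R[x_u : u ∈ I_{3,n} ∖ (123)] ⧸ (𝓕) ≅ R[a_ij]`**: Hu's chart `𝕌 ∩ Gr^{3,E}`, cut out of the
affine space `𝕌` by the primary relations, is the affine space of matrices `[I₃ | A]`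
("canonically isomorphic to the affine space with the variables of `var_𝕌` as its local free
variables"). [cite: Hu2025, Prop. 3.6] -/
def plQuotientEquiv : (MvPolynomial (HuVar m) R ⧸ plIdeal R m) ≃ₐ[R] MvPolynomial (Fin 3 × Fin m) R :=
  (Ideal.quotientEquivAlgOfEq R (ker_plEval R m).symm).trans
    (Ideal.quotientKerAlgEquivOfSurjective (plEval_surjective R m))

/-- The isomorphism on classes: `[f] ↦ plEval f`. [folklore] -/
@[simp] theorem plQuotientEquiv_mk (f : MvPolynomial (HuVar m) R) :
    plQuotientEquiv R m (Ideal.Quotient.mk _ f) = plEval R m f :=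
  rfl

/-! ### Def. 7.1: Hu's `Z_Γ` is the tree's `Spec (HuGamma.ring R m (toTriple '' Γ))` -/

/-- **Hu's ideal `I_{℘,Γ} = ⟨x_u, F̄ ∣ x_u ∈ Γ, F̄ ∈ 𝓕⟩`** of the Γ-scheme `Z_Γ ⊆ 𝕌`.
[cite: Hu2025, Def. 7.1] -/
def plGammaIdeal (Γ : Set (HuVar m)) : Ideal (MvPolynomial (HuVar m) R) :=
  plIdeal R m ⊔ Ideal.span (X '' Γ)

/-- The image of `(x_u : u ∈ Γ)` under `x_u ↦ minor_u` is the tree's ideal of Γ-minors of the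
triples `toTriple '' Γ`. [cite: Hu2025, Def. 7.1] -/
theorem map_plEval_span_X_image (Γ : Set (HuVar m)) :
    (Ideal.span (X '' Γ)).map (plEval R m) = HuGamma.ideal R m (HuVar.toTriple '' Γ) := by
  rw [HuGamma.ideal, Ideal.map_span, ← Set.image_comp, ← Set.image_comp]
  congr 1
  refine Set.image_congr fun v _ => ?_
  exact plEval_X R m v

/-- The image of `I_{℘,Γ}` under `x_u ↦ minor_u` is the ideal of Γ-minors. [cite: Hu2025, Def. 7.1] -/
theorem map_plEval_plGammaIdeal (Γ : Set (HuVar m)) :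
    (plGammaIdeal R m Γ).map (plEval R m) = HuGamma.ideal R m (HuVar.toTriple '' Γ) := by
  rw [plGammaIdeal, Ideal.map_sup, map_plEval_span_X_image,
    (Ideal.map_eq_bot_iff_le_ker _).mpr (plIdeal_le_ker R m), bot_sup_eq]

/-- `I_{℘,Γ}` contains the kernel `(𝓕)` of `x_u ↦ minor_u`. [folklore] -/
theorem ker_le_plGammaIdeal (Γ : Set (HuVar m)) : RingHom.ker (plEval R m) ≤ plGammaIdeal R m Γ := by
  rw [ker_plEval]
  exact le_sup_left

/-- `I_{℘,Γ}` is the preimage of the ideal of Γ-minors. [cite: Hu2025, Def. 7.1] -/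
theorem comap_plEval_ideal (Γ : Set (HuVar m)) :
    (HuGamma.ideal R m (HuVar.toTriple '' Γ)).comap (plEval R m) = plGammaIdeal R m Γ := by
  rw [← map_plEval_plGammaIdeal, Ideal.comap_map_of_surjective _ (plEval_surjective R m),
    ← RingHom.ker_eq_comap_bot, sup_eq_left]
  exact ker_le_plGammaIdeal R m Γ

/-- Hu's coordinate ring of `𝕌` modulo `I_{℘,Γ}`, mapped onto the tree's `HuGamma.ring`:
`x_u ↦ minor_u mod (Γ-minors)`. [cite: Hu2025, Def. 7.1] -/
def plGammaQuotMap (Γ : Set (HuVar m)) :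
    MvPolynomial (HuVar m) R →ₐ[R] HuGamma.ring R m (HuVar.toTriple '' Γ) :=
  (Ideal.Quotient.mkₐ R (HuGamma.ideal R m (HuVar.toTriple '' Γ))).comp (plEval R m)

/-- `x_u ↦ minor_u mod (Γ-minors)` is surjective. [folklore] -/
theorem plGammaQuotMap_surjective (Γ : Set (HuVar m)) :
    Function.Surjective (plGammaQuotMap R m Γ) :=
  (Ideal.Quotient.mkₐ_surjective R _).comp (plEval_surjective R m)

/-- The kernel of `x_u ↦ minor_u mod (Γ-minors)` is exactly Hu's `I_{℘,Γ}`. [cite: Hu2025, Def. 7.1] -/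
theorem ker_plGammaQuotMap (Γ : Set (HuVar m)) :
    RingHom.ker (plGammaQuotMap R m Γ) = plGammaIdeal R m Γ := by
  rw [← comap_plEval_ideal]
  ext f
  rw [RingHom.mem_ker, Ideal.mem_comap, plGammaQuotMap, AlgHom.comp_apply,
    Ideal.Quotient.mkₐ_eq_mk, Ideal.Quotient.eq_zero_iff_mem]

/-- **Hu's `Z_Γ` in his Plücker coordinates is the tree's Γ-scheme**:
`R[x_u : u ∈ I_{3,n} ∖ (123)] ⧸ I_{℘,Γ} ≅ HuGamma.ring R m (toTriple '' Γ) = R[a_ij] ⧸ (Γ-minors of [I₃ | A])`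
(Def. 7.1: `I_{℘,Γ} = ⟨x_u, F̄ ∣ x_u ∈ Γ, F̄ ∈ 𝓕⟩`). So `Spec` of Hu's `k[x_u]/I_{℘,Γ}` is the
`Spec (HuGamma.ring 𝔽 m Γ')` of `Hu2025IntegralGammaSchemeResolution`, `Γ' = toTriple '' Γ`.
[cite: Hu2025, Def. 7.1] -/
def quotientPlGammaIdealEquiv (Γ : Set (HuVar m)) :
    (MvPolynomial (HuVar m) R ⧸ plGammaIdeal R m Γ) ≃ₐ[R]
      HuGamma.ring R m (HuVar.toTriple '' Γ) :=
  (Ideal.quotientEquivAlgOfEq R (ker_plGammaQuotMap R m Γ).symm).trans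
    (Ideal.quotientKerAlgEquivOfSurjective (plGammaQuotMap_surjective R m Γ))

/-- The isomorphism on classes: `[f] ↦ [plEval f]`. [folklore] -/
@[simp] theorem quotientPlGammaIdealEquiv_mk (Γ : Set (HuVar m)) (f : MvPolynomial (HuVar m) R) :
    quotientPlGammaIdealEquiv R m Γ (Ideal.Quotient.mk _ f) =
      Ideal.Quotient.mk _ (plEval R m f) :=
  rfl

end Eval

end Literature.AlgebraicGeometry.Resolution

end
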